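import Summits.QuantumFields.YangMills.Theorems.BalabanUVNodesC44IterMhHierFrameStep
import Summits.QuantumFields.YangMills.Theorems.BalabanUVNodesC44IterMhDressing
import Literature.MathematicalPhysics.QuantumFieldTheory.Balaban1983to89.LatticeWordStokes
import HarnessLib

/-!
# [B7] (84)–(89): THE TOWER — `‖Φ_j(V) − 1‖, ‖Ψ_j(V) − 1‖ ≤ B_j` FOR EVERY LEVEL `j ≤ k` ALONG ANY NON-DECREASING BUDGET `B` THAT ABSORBS ONE STEP
# (`B_j + τ_j + 20(B_j + τ_j)² ≤ B_{j+1}`), AND THE WINDOW LETTER `‖A^{(j)}_x − 1‖ ≤ 2B_j + τ_j + (2B_j + τ_j)² < 1`; the contour dressings `τ_j` from per-bond near-one bounds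

Cell `pub-ymgap` ∕ `ym-nodeO-ideate`, porter lineage `ymgap-nodeO-port-PTB-1` (gen 10); director-ym g24 №628 (2)–(3), second brick of (T1)∕(T2).  `--kind proof --supports
stmt-QuantumFields-27238 --as helper`; count-neutral; NEW basename; generic over the averaging family `av`, the background `U₀` and the field `V`.  [B7] = [Balaban1985Averaging];
[I] = [Balaban1987RG1].

WHAT IS PROVED (0 def, 0 sorry, axioms standard; ns `Summit.QuantumFields.YangMills.Theorems.C44IterMh`).
* §1 `length_ctrWord_le` (a centre contour has `≤ d·⌊(L−1)∕2⌋` steps) · ★ `norm_ctrHolM_mul_star_sub_one_le` (the contour DRESSING `‖Z(Γ_{y,x})·W(Γ_{y,x})⋆ − 1‖ ≤ (1+2s)^{d⌊(L−1)∕2⌋} − 1`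
  from `det Z = 1` and the per-bond bound `‖Z(b)W(b)⋆ − 1‖ ≤ s ≤ ½`, by ✓`norm_dress_walk_sub_one_le`).
* §2 ★★★ `norm_framePair_sub_one_le_of_budget` — the induction over the levels with ✓`norm_frameStep_fst_sub_one_le` ∕ ✓`…snd…`: NO growth factor per level, so any budget with
  `B_0 ≥ 0`, `B_j + τ_j + 20(B_j+τ_j)² ≤ B_{j+1}`, `B_j + τ_j ≤ 1∕50` dominates both frames at every level; ★★ `norm_frameArg_framePair_sub_one_le_of_budget` — the arguments of the
  logarithms of (85) at every level `< k` are within `2B_j + τ_j + (2B_j + τ_j)²` of `1` (the (81)∕(85) half of the window `hierFrameDom`).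

HONEST FRAMING.  Bookkeeping induction; the per-level contour dressings `τ_j` and the budget are DISPLAYED (the record's instantiation — `τ_j ≈ 32000·L·L^j‖Y‖` from ✓Polydisc,
`B_j = 35000·L^j‖Y‖` — is the next file); nothing of [B7] Prop. 5 ∕ (101)–(112)'s Hölder bounds, [B11] Prop. 4 proved; K0ᴬ ⟨stmt-QuantumFields-27238⟩ NOT closed; NODE O 0∕1;
COUNT 8∕28 · K 1∕4 UNMOVED; finite `𝕋⁴_{L^K}` at fixed ε — NOT continuum ∕ OS ∕ Clay; **the Yang–Mills mass gap (Clay) is NOT proved by any of this.**  No `sorry`, `instance`,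
`notation`, `set_option`; standard axioms.
-/

noncomputable section

open scoped Matrix Matrix.Norms.L2Operator Topology

namespace Summit.QuantumFields.YangMills.Theorems.C44IterMh

open Literature.MathematicalPhysics.QuantumFieldTheory.Balaban1983to89
open Literature.MathematicalPhysics.QuantumFieldTheory.Balaban1983to89.Node00
open T4Continuum BlockAveraging
open B15AveragingHolomorphic (holMh iterMh)
open LatticeWordStokes (length_stairWord_le)

variable {P : Params} {N : ℕ} [NeZero N] {j : ℕ}

/-! ## §1  The contour dressing from per-bond near-one bounds -/

omit [NeZero N] in
/-- A centre contour `Γ_{y,x_r}` has at most `d·⌊(L−1)∕2⌋` steps (`|off r ν| ≤ (L−1)∕2` in every direction). [cite: Balaban1987RG1, (0.3) p.252; Balaban1985Averaging, (42) p.23] -/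
theorem length_ctrWord_le (r : Fin P.d → Fin P.L) : (ctrWord P r).length ≤ P.d * ((P.L - 1) / 2) := by
  rw [ctrWord]
  refine length_stairWord_le _ (off r) _ fun ν => ?_
  have h := off_bounds r ν
  omega

/-- ★ **THE CONTOUR DRESSING**: for a level-`j` matrix field `Z` with `det Z = 1` and `‖Z(b)·W(b)⋆ − 1‖ ≤ s ≤ ½` at every bond, the transporter along a centre contour satisfies
`‖Z(Γ_{y,x_r})·W(Γ_{y,x_r})⋆ − 1‖ ≤ (1 + 2s)^{d⌊(L−1)∕2⌋} − 1` (✓`norm_dress_walk_sub_one_le`: concatenation with unitary rotation; backward steps cost `2s`).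
[cite: Balaban1985Averaging, (47) p.25, (58) p.27, (111) p.34] -/
theorem norm_ctrHolM_mul_star_sub_one_le (W : GaugeField P j (SU N)) {Z : PBond P j → Matrix (Fin N) (Fin N) ℂ} (hdet : ∀ b, (Z b).det = 1) {s : ℝ}
    (hs : ∀ b, ‖Z b * star (W b : Matrix (Fin N) (Fin N) ℂ) - 1‖ ≤ s) (hs2 : s ≤ 1 / 2) (y : Site P (j + 1)) (r : Fin P.d → Fin P.L) :
    ‖ctrHolM Z y r * star ((ctrHol W y r : SU N) : Matrix (Fin N) (Fin N) ℂ) - 1‖ ≤ (1 + 2 * s) ^ (P.d * ((P.L - 1) / 2)) - 1 := by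
  have hs0 : 0 ≤ s := (norm_nonneg _).trans (hs ⟨emb y, ⟨0, P.hd⟩⟩)
  rw [ctrHolM, ctrHol, coe_holAt]
  refine (norm_dress_walk_sub_one_le W hdet hs hs2 (emb y) (ctrWord P r)).trans ?_
  have h1 : (1 : ℝ) ≤ 1 + 2 * s := by linarith
  linarith [pow_le_pow_right₀ h1 (length_ctrWord_le (P := P) r)]

/-! ## §2  The tower along a budget -/

/-- ★★★ **THE HIERARCHICAL FRAMES STAY NEAR `1` ALONG ANY ONE-STEP-ABSORBING BUDGET**: if the contour dressings of the un-framed iterates are `≤ τ_j` at every level `j < k` and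
`B : ℕ → ℝ` satisfies `0 ≤ B 0`, `B_j + τ_j + 20(B_j + τ_j)² ≤ B_{j+1}`, `B_j + τ_j ≤ 1∕50` (`j < k`), then `‖Φ_j(V)(x) − 1‖, ‖Ψ_j(V)(x) − 1‖ ≤ B_j` for all `j ≤ k` and all `x`
(induction with ✓`norm_frameStep_fst_sub_one_le` ∕ ✓`norm_frameStep_snd_sub_one_le`; `Ψ_jΦ_j = 1` by ✓`framePair_snd_mul_fst`).
[cite: Balaban1985Averaging, (84)–(89) pp.30–31, (101)–(106) p.33] -/
theorem norm_framePair_sub_one_le_of_budget (av : ∀ j, Averaging P j (SU N)) (U₀ : GaugeField P 0 (SU N)) (V : PBond P 0 → Matrix (Fin N) (Fin N) ℂ)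
    (k : ℕ) (τ B : ℕ → ℝ)
    (hτ : ∀ j, j < k → ∀ (y : Site P (j + 1)) (r : Fin P.d → Fin P.L),
      ‖ctrHolM (iterMh j V) y r * star ((ctrHol (Averaging.iter av j U₀) y r : SU N) : Matrix (Fin N) (Fin N) ℂ) - 1‖ ≤ τ j)
    (hB0 : 0 ≤ B 0) (hstep : ∀ j, j < k → B j + τ j + 20 * (B j + τ j) ^ 2 ≤ B (j + 1)) (hsmall : ∀ j, j < k → B j + τ j ≤ 1 / 50) :
    ∀ j, j ≤ k → ∀ x : Site P j, ‖(framePair av U₀ V j x).1 - 1‖ ≤ B j ∧ ‖(framePair av U₀ V j x).2 - 1‖ ≤ B j := by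
  intro j
  induction j with
  | zero => intro _ x; simp only [framePair_zero, sub_self, norm_zero]; exact ⟨hB0, hB0⟩
  | succ j ih =>
    intro hj y
    have hjk : j < k := hj
    have ih' := ih hjk.le
    rw [framePair_succ]
    refine ⟨(norm_frameStep_fst_sub_one_le (iterMh j V) (Averaging.iter av j U₀) (framePair av U₀ V j) y
        (framePair_snd_mul_fst av U₀ V j (emb y)) (ih' _).1 (ih' _).2 (fun r => (ih' _).1) (hτ j hjk y) (hsmall j hjk)).trans (hstep j hjk),
      (norm_frameStep_snd_sub_one_le (iterMh j V) (Averaging.iter av j U₀) (framePair av U₀ V j) y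
        (ih' _).2 (fun r => (ih' _).1) (hτ j hjk y) (hsmall j hjk)).trans (hstep j hjk)⟩

/-- ★★ **THE WINDOW LETTER ALONG THE BUDGET**: under the same hypotheses, at every level `j < k` the arguments of the logarithms of (85) satisfy
`‖A^{(j)}_{y,x} − 1‖ ≤ 2B_j + τ_j + (2B_j + τ_j)²` (`≤ 1∕25 + 1∕625 < 1`: inside `log`'s disc of analyticity — the second half of `hierFrameDom`).
[cite: Balaban1985Averaging, (81) p.30, (85) p.30] -/
theorem norm_frameArg_framePair_sub_one_le_of_budget (av : ∀ j, Averaging P j (SU N)) (U₀ : GaugeField P 0 (SU N)) (V : PBond P 0 → Matrix (Fin N) (Fin N) ℂ)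
    (k : ℕ) (τ B : ℕ → ℝ)
    (hτ : ∀ j, j < k → ∀ (y : Site P (j + 1)) (r : Fin P.d → Fin P.L),
      ‖ctrHolM (iterMh j V) y r * star ((ctrHol (Averaging.iter av j U₀) y r : SU N) : Matrix (Fin N) (Fin N) ℂ) - 1‖ ≤ τ j)
    (hB0 : 0 ≤ B 0) (hstep : ∀ j, j < k → B j + τ j + 20 * (B j + τ j) ^ 2 ≤ B (j + 1)) (hsmall : ∀ j, j < k → B j + τ j ≤ 1 / 50)
    {j : ℕ} (hjk : j < k) (y : Site P (j + 1)) (r : Fin P.d → Fin P.L) :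
    ‖frameArg (iterMh j V) (Averaging.iter av j U₀) (framePair av U₀ V j) y r - 1‖ ≤ (2 * B j + τ j) + (2 * B j + τ j) ^ 2 := by
  have ih := norm_framePair_sub_one_le_of_budget av U₀ V k τ B hτ hB0 hstep hsmall j hjk.le
  have hτ0 : 0 ≤ τ j := (norm_nonneg _).trans (hτ j hjk y r)
  have hB : 0 ≤ B j := (norm_nonneg _).trans (ih (emb y)).1
  exact norm_frameArg_sub_one_le (iterMh j V) (Averaging.iter av j U₀) (framePair av U₀ V j) y r (ih _).2 (ih _).1 (hτ j hjk y r)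
    (by linarith [hsmall j hjk])

end Summit.QuantumFields.YangMills.Theorems.C44IterMh

end
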